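import Literature.NumberTheory.EllipticCurves.ZpExtensionEisensteinTowerReadoutCurve
import Literature.NumberTheory.EllipticCurves.ZpExtensionSubgroupH1TorsionCoefficientsProofs
import Literature.NumberTheory.EllipticCurves.GaloisActionProofs
import HarnessLib

/-!
# Howard's readout `H¹(K, A_𝔮) → H¹(K_∞, E[p^∞])[𝔮]` is a bijection onto the `𝔮`-torsion (proofs file)

Topic `NumberTheory/EllipticCurves` (cell `pub/bsd-print-x9`, blueprint HOME/p2/S1-DISCRETE-CONTROL §1(c)/(d) at the limit;
sequel to `ZpExtensionEisensteinTowerReadoutCurve` (p662975: the readout `WeierstrassCurve.eisensteinTowerReadout`, killed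
by `ψ_m`, injective modulo two bricks) and `ZpExtensionSubgroupH1TorsionCoefficientsProofs` (p664720: the bricks from
`E(K)[p] = 0`, and the surjectivity `H¹(K_∞, E[p^k]) ↠ H¹(K_∞, E[p^∞])[p^k]`)). THEOREMS ONLY; no definition, no named
fact, no instance, no `sorry`.

For `E = W_K` (`W/ℚ`, `K` a number field), a `ℤ_p`-extension `κ` with topological generator `γ`, `m ≥ 1`,
`𝔮 = q_m = ((γ − 1)^m + p)`, `A_𝔮 = colim_k E[p^{k+1}] ⊗ A_{m,k+1}(ψ⁻¹)` (D1's tower `W.eisensteinTower (κ.unitTwist (-1)) hm`)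
and `ψ_m = (conj_γ − 1)^m + p` on `H¹(K_∞, E[p^∞])`:

* `WeierstrassCurve.eisensteinTowerReadout_injective` — **the readout `H¹(K, A_𝔮) → H¹(K_∞, E[p^∞])` is injective**
  when `E(K)[p] = 0` (binder **(B1)** of the discrete half of the shared μ-crux's `stub_controlGlue`);
* `WeierstrassCurve.exists_eisensteinTowerReadout_eq` — **it is onto `H¹(K_∞, E[p^∞])[ψ_m]`** when `E(K)[p] = 0`
  (binder **(B2)**): a `ψ_m`-torsion class is `p^{k+1}`-torsion for some `k`, comes from `H¹(K_∞, E[p^{k+1}])[ψ_m]`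
  (surjectivity + injectivity of the coefficient map), hence from level `k` of the tower by the levelwise surjectivity
  `exists_eisensteinTwistLevelReadout_eq` (inflation–restriction with `E(K_∞)[p] = 0`).

Together with `psi_apply_eisensteinTowerReadout_eq_zero` (p662975): `H¹(K, A_𝔮) ≅ H¹(K_∞, E[p^∞])[𝔮]`, Howard's
identification in the proof of Thm. 2.2.10 / Prop. 2.2.8 («`H¹(K, A_𝔮) → H¹(K_∞, A)[𝔮]`») for `𝔮 = T^m + p`, on full `H¹`
(before local conditions).  BSD is not proved by any of this.

References: [Howard2004HeegnerKolyvagin] §2.2, Lemma 2.2.9, Prop. 2.2.8, proof of Thm. 2.2.10 (arXiv:1202.6340 p. 17–18);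
[GreenbergLNM1716] §4 pp. 98, 107, 124.
-/

noncomputable section

open scoped Classical

open Literature.NumberTheory.EllipticCurves Literature.NumberTheory.GaloisRepresentations Field
open Literature.NumberTheory.GaloisCohomology.Howard2004
open Literature.NumberTheory.EllipticCurves.ZpExtension (EisensteinLevel eisensteinLevel apply_psi_apply_of_comm)
open IwasawaAlgebra IwasawaAlgebra.EisensteinCoeff IwasawaAlgebra.EisensteinCoeff.TwistedBy
open scoped ContRepresentation

namespace WeierstrassCurve

variable {K : Type} [Field K] [NumberField K] (W : WeierstrassCurve ℚ) [W.IsElliptic] {p : ℕ} [hp : Fact p.Prime]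
  (κ : ZpExtension K p) {m : ℕ} (hm : 1 ≤ m)

variable (π : IwasawaAlgebra p ⧸ Ideal.span {(PowerSeries.X ^ m + PowerSeries.C (p : ℤ_[p]) : IwasawaAlgebra p)})
  (e : ℕ → ℕ)
  (hkill : letI := IwasawaAlgebra.isLocalRing_quotient_X_pow_add_C p hm
    ∀ k, ∀ r ∈ IsLocalRing.maximalIdeal
      (IwasawaAlgebra p ⧸ Ideal.span {(PowerSeries.X ^ m + PowerSeries.C (p : ℤ_[p]) : IwasawaAlgebra p)}) ^ e k,
      ∀ x : EisensteinLevel p m (fun j ↦ geomTorsion (W.baseChange K) ((p : ℤ) ^ j)) (k + 1), r • x = 0)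
  (hker : letI := IwasawaAlgebra.isLocalRing_quotient_X_pow_add_C p hm
    ∀ k, LinearMap.ker ((W.eisensteinTower (κ.unitTwist (-1)) hm).red k) =
      (IsLocalRing.maximalIdeal
        (IwasawaAlgebra p ⧸ Ideal.span {(PowerSeries.X ^ m + PowerSeries.C (p : ℤ_[p]) : IwasawaAlgebra p)}) ^ e k) •
        (⊤ : Submodule (IwasawaAlgebra p ⧸ Ideal.span {(PowerSeries.X ^ m + PowerSeries.C (p : ℤ_[p]) : IwasawaAlgebra p)})
          (EisensteinLevel p m (fun j ↦ geomTorsion (W.baseChange K) ((p : ℤ) ^ j)) (k + 1 + 1))))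
  (hπ : letI := IwasawaAlgebra.isLocalRing_quotient_X_pow_add_C p hm
    π ∈ IsLocalRing.maximalIdeal
      (IwasawaAlgebra p ⧸ Ideal.span {(PowerSeries.X ^ m + PowerSeries.C (p : ℤ_[p]) : IwasawaAlgebra p)}))
  (he : ∀ k, e k ≤ e (k + 1))
  (hπX : π = Ideal.Quotient.mk _ PowerSeries.X) (hek : ∀ k, e (k + 1) - e k = m)

/-- **(B1) Howard's readout `H¹(K, A_𝔮) → H¹(K_∞, E[p^∞])` is injective when `E(K)[p] = 0`**: p662975's
`eq_zero_of_eisensteinTowerReadout_eq_zero` with both bricks — `E[p^k]^{Gal(K̄/K_∞)} = 0` and the injectivity of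
`H¹(K_∞, E[p^{k+1}]) → H¹(K_∞, E[p^∞])` — discharged from `E(K)[p] = 0` (p664720).
[cite: Howard2004HeegnerKolyvagin, §2.2, Lemma 2.2.9 and proof of Thm. 2.2.10] [cite: GreenbergLNM1716, §4 pp. 109, 124] -/
theorem eisensteinTowerReadout_injective {γ : absoluteGaloisGroup K} (hγ : κ.IsTopGenerator γ)
    (hE : ∀ P : (W.baseChange K).toAffine.Point, p • P = 0 → P = 0) :
    letI := IwasawaAlgebra.isLocalRing_quotient_X_pow_add_C p hm
    Function.Injective (W.eisensteinTowerReadout κ hm π e hkill hker hπ he hπX hek) := by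
  letI := IwasawaAlgebra.isLocalRing_quotient_X_pow_add_C p hm
  rw [injective_iff_map_eq_zero]
  exact W.eq_zero_of_eisensteinTowerReadout_eq_zero κ hm π e hkill hker hπ he hπX hek hγ
    (fun k a ha ↦ (W.baseChange K).geomTorsion_eq_zero_of_forall_kerSubgroup_smul_eq κ hE k a ha)
    (fun k ↦ (W.baseChange K).resH1Hom_inclusion_geomTorsion_injective κ hE (k + 1))

omit [W.IsElliptic] in
/-- The coefficient map `H¹(K_∞, E[p^{k+1}]) → H¹(K_∞, E[p^∞])` intertwines `conj_γ` on both sides (both composites are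
induced by one compatible pair). [cite: GreenbergLNM1716, §4 p. 124] -/
theorem resH1Hom_inclusion_conjH1 (γ : absoluteGaloisGroup K) (k : ℕ)
    (a : Literature.NumberTheory.EllipticCurves.subgroupH1 κ.kerSubgroup (geomTorsion (W.baseChange K) ((p : ℤ) ^ k))) :
    resH1Hom (ContinuousMonoidHom.id κ.kerSubgroup)
        (AddSubgroup.inclusion (AcSigned.geomTorsion_zpow_le_geomPrimaryTorsion (W.baseChange K) p k)) (fun _ _ ↦ rfl)
        (Literature.NumberTheory.EllipticCurves.conjH1 κ.kerSubgroup (geomTorsion (W.baseChange K) ((p : ℤ) ^ k)) γ a) =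
      (W.baseChange K).conjH1 p κ.kerSubgroup γ
        (resH1Hom (ContinuousMonoidHom.id κ.kerSubgroup)
          (AddSubgroup.inclusion (AcSigned.geomTorsion_zpow_le_geomPrimaryTorsion (W.baseChange K) p k)) (fun _ _ ↦ rfl)
          a) := by
  have h := congrArg (fun f : _ →+ (W.baseChange K).subgroupH1 p κ.kerSubgroup ↦ f a)
    (IwasawaDual.conjH1_comp_resH1Hom_id κ
      (AddSubgroup.inclusion (AcSigned.geomTorsion_zpow_le_geomPrimaryTorsion (W.baseChange K) p k))
      (fun _ _ ↦ rfl) (fun _ _ ↦ rfl) γ)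
  exact h.symm

/-- **(B2) Howard's readout is onto `H¹(K_∞, E[p^∞])[ψ_m]`, `ψ_m = (conj_γ − 1)^m + p`, when `E(K)[p] = 0`.**
A class `s` with `ψ_m s = 0` is `p^{k+1}`-torsion for some `k`, so `s = ι_* s'` with `s' ∈ H¹(K_∞, E[p^{k+1}])`
(p664720 `exists_resH1Hom_inclusion_geomTorsion_eq_of_subgroupH1`); `ψ_m s' = 0` because `ι_*` is injective and commutes
with `conj_γ`; then `s'` is the level-`(k+1)` readout of a class `c` of `H¹(K, E[p^{k+1}] ⊗ A_{m,k+1}(ψ⁻¹))`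
(`exists_eisensteinTwistLevelReadout_eq`: inflation–restriction with `E[p^{k+1}]^{Gal(K̄/K_∞)} = 0`), and the tower
readout of `(-1)^k [c]` at level `k` is `s`. Howard: «`H¹(K, A_𝔮) → H¹(K_∞, A)[𝔮]`» in the proof of Thm. 2.2.10 /
Prop. 2.2.8. [cite: Howard2004HeegnerKolyvagin, §2.2, Prop. 2.2.8 and proof of Thm. 2.2.10] [cite: GreenbergLNM1716, §4 pp. 107, 124] -/
theorem exists_eisensteinTowerReadout_eq {γ : absoluteGaloisGroup K} (hγ : κ.IsTopGenerator γ)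
    (hE : ∀ P : (W.baseChange K).toAffine.Point, p • P = 0 → P = 0)
    (θ : AddMonoid.End ((W.baseChange K).subgroupH1 p κ.kerSubgroup))
    (hθ : ∀ c, θ c = (W.baseChange K).conjH1 p κ.kerSubgroup γ c)
    (s : (W.baseChange K).subgroupH1 p κ.kerSubgroup)
    (hs : ((θ - 1) ^ m + (p : AddMonoid.End ((W.baseChange K).subgroupH1 p κ.kerSubgroup))) s = 0) :
    letI := IwasawaAlgebra.isLocalRing_quotient_X_pow_add_C p hm
    ∃ x : AdicTower.H1A (W.eisensteinTower (κ.unitTwist (-1)) hm) π e hkill hker hπ he,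
      W.eisensteinTowerReadout κ hm π e hkill hker hπ he hπX hek x = s := by
  letI := IwasawaAlgebra.isLocalRing_quotient_X_pow_add_C p hm
  -- (1) `s = ι_* s'` from some level `k + 1`
  obtain ⟨k', hk', s', rfl⟩ := (W.baseChange K).exists_resH1Hom_inclusion_geomTorsion_eq_of_subgroupH1 κ 1 s
  obtain ⟨k, rfl⟩ : ∃ k, k' = k + 1 := ⟨k' - 1, (Nat.sub_add_cancel hk').symm⟩
  -- (2) `ψ_m s' = 0`
  set θ' : AddMonoid.End (Literature.NumberTheory.EllipticCurves.subgroupH1 κ.kerSubgroup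
      (geomTorsion (W.baseChange K) ((p : ℤ) ^ (k + 1)))) :=
    Literature.NumberTheory.EllipticCurves.conjH1 κ.kerSubgroup (geomTorsion (W.baseChange K) ((p : ℤ) ^ (k + 1))) γ
    with hθ'
  have hs' : ((θ' - 1) ^ m + (p : AddMonoid.End (Literature.NumberTheory.EllipticCurves.subgroupH1 κ.kerSubgroup
      (geomTorsion (W.baseChange K) ((p : ℤ) ^ (k + 1)))))) s' = 0 := by
    apply (W.baseChange K).resH1Hom_inclusion_geomTorsion_injective κ hE (k + 1)
    rw [map_zero, apply_psi_apply_of_comm _ θ' θ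
      (fun a ↦ (W.resH1Hom_inclusion_conjH1 κ γ (k + 1) a).trans (hθ _).symm)]
    exact hs
  -- (3) levelwise surjectivity at level `k + 1`
  haveI : Finite (geomTorsion (W.baseChange K) ((p : ℤ) ^ (k + 1))) :=
    finite_torsionPoints_holds (W.baseChange K) (AlgebraicClosure K)
      (pow_ne_zero _ (Int.natCast_ne_zero.mpr hp.out.ne_zero))
  obtain ⟨c, hc⟩ := (κ.unitTwist (-1)).exists_eisensteinTwistLevelReadout_eq hm (k + 1)
    ((κ.unitTwist (-1)).eisensteinTwistChar hm (k + 1)) ((W.baseChange K).torsionGaloisModule ((p : ℤ) ^ (k + 1)))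
    (fun σ x ↦ (κ.unitTwist (-1)).eisensteinTwist_torsionGaloisModule_apply hm (k + 1) (W.baseChange K) _ σ x) κ
    (fun a ↦ (W.baseChange K).geomTorsion_pow_nsmul_eq_zero p (k + 1) a)
    (fun _ hσ ↦ κ.eisensteinTwistChar_unitTwist_eq_one_of_mem_kerSubgroup hm (k + 1) (-1) hσ) hγ
    (κ.eisensteinTwistChar_unitTwist_neg_one_mul_onePlusT hm (k + 1) hγ)
    (κ.layerSubgroup (eisensteinLevel (p := p) hm (k + 1))) (κ.isOpen_layerSubgroup _)
    (fun _ hσ ↦ κ.eisensteinTwistChar_unitTwist_eq_one_of_mem_layerSubgroup hm (k + 1) (-1) hσ)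
    (fun a ↦ by
      have h := isOpen_stabilizer_point_holds (W.baseChange K) (a : geomPoints (W.baseChange K))
      convert h using 1
      ext σ
      simp only [SetLike.mem_coe, MulAction.mem_stabilizer_iff, Subtype.ext_iff, AddSubgroup.torsionBy.coe_smul])
    (fun a ha ↦ (W.baseChange K).geomTorsion_eq_zero_of_forall_kerSubgroup_smul_eq κ hE (k + 1) a ha)
    θ' (fun _ ↦ rfl) s' hs'
  -- (4) the tower readout of `(-1)^k • [c]` at level `k` is `ι_* s'`
  refine ⟨AddCommGroup.DirectLimit.of _ _ k (((-1 : ℤ) ^ k) • c), ?_⟩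
  rw [WeierstrassCurve.eisensteinTowerReadout, ZpExtension.eisensteinTowerReadout_of, map_zsmul,
    ZpExtension.eisensteinTowerLevelMap_apply, hc, ← mul_zsmul, ← pow_add, Even.neg_one_pow ⟨k, rfl⟩, one_zsmul]

end WeierstrassCurve
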